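import Mathlib
import Literature.NumberTheory.Automorphic.HilbertModularFormQExpansion

/-!
# Distinct leading points ⇒ linear independence (stub U6 of line Sketch-ideate-r1-k1)

Crux `HilbertIntegralOverconvergentIsCongruence` (stmt-Langlands-8485), line `Sketch-ideate-r1-k1`,
§ U, registered stub U6 `stub_distinct_lead_indep`.

Coefficient functions `A e : X → ℂ` (`e` in a finite index type) with pairwise distinct LEADING
POINTS `lead e` — `A e (lead e) ≠ 0` and `A e ν ≠ 0 ⇒ λ(lead e) ≤ λ ν` for an injective height
`λ : X → ℝ` — are linearly independent.

Proof outline: suppose some `κ e ≠ 0`; among the indices with `κ e ≠ 0` pick `e₀` minimising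
`λ (lead e)` (`Finset.exists_min_image`).  Evaluating the relation at `lead e₀`, every other index
`e` with `κ e ≠ 0` has `λ (lead e₀) < λ (lead e)` (minimality plus injectivity of `lead` and `λ`),
so `A e (lead e₀) = 0` by the leading-point property; hence the sum collapses to
`κ e₀ * A e₀ (lead e₀) ≠ 0`, contradicting the relation.
-/

set_option linter.dupNamespace false

noncomputable section

namespace Summit.Langlands.Langlands.Theorems.HilbertIntegralOverconvergentIsCongruence

/-- **Distinct leading points ⇒ linear independence.** Coefficient functions `A e : X → ℂ`
(`e` in a finite index type) with pairwise distinct leading points `lead e` — `A e (lead e) ≠ 0`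
and `A e ν ≠ 0 ⇒ lam (lead e) ≤ lam ν` for an injective `lam : X → ℝ` — are linearly
independent: a relation `∑_e κ_e A e = 0` forces `κ = 0`.  Evaluate at the leading point of the
index `e₀` with `κ_{e₀} ≠ 0` and `lam (lead e₀)` minimal; every other `e` with `κ_e ≠ 0` has
`lam (lead e) > lam (lead e₀)` and so `A e (lead e₀) = 0`. [folklore] -/
theorem stub_distinct_lead_indep {X ι : Type} [Fintype ι] (lam : X → ℝ) (hlam : Function.Injective lam)
    (A : ι → X → ℂ) (lead : ι → X) (hlead : Function.Injective lead)
    (hlc : ∀ e, A e (lead e) ≠ 0) (hmin : ∀ e ν, A e ν ≠ 0 → lam (lead e) ≤ lam ν)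
    (κ : ι → ℂ) (hrel : ∀ ν, ∑ e, κ e * A e ν = 0) : ∀ e, κ e = 0 := by
  classical
  by_contra h
  obtain ⟨e₁, he₁⟩ := not_forall.mp h
  -- the nonempty finite set of indices carrying a non-zero coefficient
  have hTne : (Finset.univ.filter fun e => κ e ≠ 0).Nonempty :=
    ⟨e₁, Finset.mem_filter.mpr ⟨Finset.mem_univ e₁, he₁⟩⟩
  -- an index `e₀` with `κ e₀ ≠ 0` minimising the height of its leading point
  obtain ⟨e₀, he₀T, he₀min⟩ :=
    (Finset.univ.filter fun e => κ e ≠ 0).exists_min_image (fun e => lam (lead e)) hTne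
  have hκ₀ : κ e₀ ≠ 0 := (Finset.mem_filter.mp he₀T).2
  -- evaluating the relation at `lead e₀`, only the `e₀`-term survives
  have hsum : ∑ e, κ e * A e (lead e₀) = κ e₀ * A e₀ (lead e₀) := by
    refine Fintype.sum_eq_single e₀ (fun e hne => ?_)
    by_cases hκe : κ e = 0
    · rw [hκe, zero_mul]
    · by_cases hA : A e (lead e₀) = 0
      · rw [hA, mul_zero]
      · exfalso
        have hle : lam (lead e₀) ≤ lam (lead e) :=
          he₀min e (Finset.mem_filter.mpr ⟨Finset.mem_univ e, hκe⟩)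
        have hne' : lam (lead e₀) ≠ lam (lead e) := fun h' => hne (hlead (hlam h')).symm
        exact not_lt.mpr (hmin e (lead e₀) hA) (lt_of_le_of_ne hle hne')
  exact mul_ne_zero hκ₀ (hlc e₀) (hsum.symm.trans (hrel (lead e₀)))

end Summit.Langlands.Langlands.Theorems.HilbertIntegralOverconvergentIsCongruence

end
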